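import Literature.NumberTheory.EllipticCurves.PointReduction
import Literature.NumberTheory.EllipticCurves.Cm7KernelDescent
import HarnessLib

/-!
# `𝔓`-integrality of division points of `X₀(49)` from the CM ORBIT, and the unit `x(P) − x(Q)` by reduction
# (de Shalit II §4.9 (i): «the coefficients of `Θ(Ω − v; L, 𝔞)` are `𝔓`-integral and `℘(Ω) − ℘(v)` is a `𝔓`-unit»; proofs only)

Topic `NumberTheory/EllipticCurves` (theorems only; no definition, no named fact, no instance, no `sorry`).  Cell `bsd-print-cf2`,
width seat `bsd-line-cf2-p1-w7` g16, piece RP-INT (LEAD R-RP-INT): the LOCAL half of the discharge of the integrality / unit hypotheses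
of `KatzMeasureJZeroSeam.exists_thetaDatum_readingRing` (the theta datum over the `𝔓`-adic reading ring).

Setting: a valued field `(F, w)` (`w : Valuation F ℝ≥0`) of residue characteristic `2` (`w 2 < 1`), an element `ϖ` with `w ϖ < 1`
(the image of `π₀ = ψ(𝔭)`, `𝔭 = (π₀) ∣ 2` split), and the model `V = [1,−1,0,−2,−1]` of `X₀(49)` (`y² + xy = x³ − x² − 2x − 1`,
`Δ = −7³`, good ordinary reduction at `2`).

* §1 ★ **Growth along the CM orbit.**  The `x`-coordinates `X_k = x(ξ(π₀ᵏz))` (model coordinates, `x = ℘ + ¼`) satisfy the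
  value identity `X_{k+1}·(4X_k + 3 − ϖ) = (−1 − ϖ)X_k² + (2ϖ − 2)` (the re-centred transformation pair of
  `CMTransformationPairSeven`, read `𝔓`-adically).  If `|X_0| > 1` then `k ↦ |X_k|` is STRICTLY INCREASING (`val_lt_val_of_step`,
  `strictMono_val_of_orbit`): `|X_{k+1}| = |X_k|²/|4X_k + 3 − ϖ| ≥ min(|X_k|², |X_k|/|4|) > |X_k|`.  Since the orbit `π₀ᵏz mod L` of
  a division point of order prime to `𝔭` is PERIODIC, `|X_0| ≤ 1` (`val_le_one_of_orbit`) — integrality with no use of the group law.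
  `val_y_le_one` (`Cm7KernelDescent`) then gives the `y`-coordinate.
* §2 `val_Δ_cm7` — `|Δ| = 1` (`Δ = −343 = −(−1 + 8)³`).
* §3 ★ **The unit.**  For `w`-integral points `P = (x₁,y₁)`, `Q = (x₂,y₂)` of `V(F)` with `P ± Q` integral and `P ≠ ±Q`:
  `|x₁ − x₂| = 1` (`val_sub_eq_one_of_isIntegralPoint`) — by reduction modulo `𝔪_w` (`PointReduction`: `x̃₁ = x̃₂` forces `P̃ = ±Q̃`,
  and the reduction of integral points is additive and detects `O`; Silverman VII.2.1), the residue map being built from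
  Mathlib's `Valuation.valuationSubring`.

No summit statement is proved; BSD is not proved by any of this.

## References
* [deShalit1987] E. de Shalit, *Iwasawa theory of elliptic curves with complex multiplication* (1987), II §1.10 (p. 39), II §4.9
  Proposition (i) and its proof (p. 62–63).
* [SilvermanAEC2009] J. H. Silverman, *The Arithmetic of Elliptic Curves*, 2nd ed. (2009), Prop. VII.2.1, VII.2.2, Prop. VII.3.1.
-/

noncomputable section

open scoped Classical NNReal
open WeierstrassCurve

namespace Literature.NumberTheory.EllipticCurves

namespace Cm7Orbit

variable {F : Type*} [Field F] {w : Valuation F ℝ≥0}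

/-! ## §1 Growth of `|x|` along the CM orbit and integrality by periodicity -/

/-- `w 3 = 1` and `w (3 − ϖ) = 1` for `w 2 < 1`, `w ϖ < 1`. [folklore] -/
private theorem val_three_sub (h2 : w 2 < 1) {ϖ : F} (hϖ : w ϖ < 1) : w (3 - ϖ) = 1 := by
  have h3 : w 3 = 1 := by
    rw [show (3 : F) = 1 + 2 by norm_num]; exact w.map_one_add_of_lt h2
  rw [sub_eq_add_neg, w.map_add_eq_of_lt_left (by rwa [h3, Valuation.map_neg]), h3]

/-- `w (−1 − ϖ) = 1` for `w ϖ < 1`. [folklore] -/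
private theorem val_neg_one_sub {ϖ : F} (hϖ : w ϖ < 1) : w (-1 - ϖ) = 1 := by
  rw [show (-1 - ϖ : F) = -(1 + ϖ) by ring, Valuation.map_neg, w.map_one_add_of_lt hϖ]

/-- ★ **One step of the orbit: `|X| < |X′|`** when `1 < |X|` and `X′·(4X + 3 − ϖ) = (−1 − ϖ)X² + (2ϖ − 2)`.
[cite: deShalit1987, II §4.9 (i) (proof, p. 62–63)] [cite: SilvermanAEC2009, VII.2.2] -/
theorem val_lt_val_of_step (h2 : w 2 < 1) {ϖ : F} (hϖ : w ϖ < 1) {X X' : F} (hX : 1 < w X)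
    (hrec : X' * (4 * X + 3 - ϖ) = (-1 - ϖ) * X ^ 2 + (2 * ϖ - 2)) : w X < w X' := by
  have hX0 : 0 < w X := zero_lt_one.trans hX
  -- the right-hand side has valuation `|X|²`
  have hc : w (2 * ϖ - 2) < w ((-1 - ϖ) * X ^ 2) := by
    rw [Valuation.map_mul, val_neg_one_sub hϖ, one_mul, Valuation.map_pow]
    have h1 : w (2 * ϖ - 2) < 1 := by
      rw [show (2 * ϖ - 2 : F) = 2 * (ϖ - 1) by ring, Valuation.map_mul]
      refine mul_lt_one_of_nonneg_of_lt_one_left bot_le h2 ?_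
      exact (w.map_sub _ _).trans (max_le hϖ.le (by rw [Valuation.map_one]))
    exact h1.trans (one_lt_pow₀ hX two_ne_zero)
  have hR : w ((-1 - ϖ) * X ^ 2 + (2 * ϖ - 2)) = w X ^ 2 := by
    rw [w.map_add_eq_of_lt_left hc, Valuation.map_mul, val_neg_one_sub hϖ, one_mul, Valuation.map_pow]
  -- hence the left-hand side is non-zero
  have hprod : w X' * w (4 * X + 3 - ϖ) = w X ^ 2 := by rw [← Valuation.map_mul, hrec, hR]
  have hQ0 : 0 < w (4 * X + 3 - ϖ) := by
    rw [pos_iff_ne_zero]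
    intro h0
    rw [h0, mul_zero] at hprod
    exact (pow_ne_zero 2 hX0.ne') hprod.symm
  -- two cases according to `|4X| ≶ 1`
  by_cases h4 : w 4 * w X ≤ 1
  · -- `|4X + 3 − ϖ| ≤ 1`, so `|X′| ≥ |X|² > |X|`
    have hQ : w (4 * X + 3 - ϖ) ≤ 1 := by
      rw [show (4 * X + 3 - ϖ : F) = 4 * X + (3 - ϖ) by ring]
      exact (w.map_add _ _).trans (max_le (by rwa [Valuation.map_mul]) (val_three_sub h2 hϖ).le)
    calc w X < w X ^ 2 := by rw [sq]; exact lt_mul_of_one_lt_left hX0 hX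
      _ = w X' * w (4 * X + 3 - ϖ) := hprod.symm
      _ ≤ w X' * 1 := mul_le_mul_of_nonneg_left hQ bot_le
      _ = w X' := mul_one _
  · -- `|4X + 3 − ϖ| = |4|·|X|`, so `|X′| = |X|/|4| > |X|`
    push Not at h4
    have hQ : w (4 * X + 3 - ϖ) = w 4 * w X := by
      rw [show (4 * X + 3 - ϖ : F) = 4 * X + (3 - ϖ) by ring, w.map_add_eq_of_lt_left, Valuation.map_mul]
      rwa [val_three_sub h2 hϖ, Valuation.map_mul]
    have h4lt : w 4 < 1 := by
      rw [show (4 : F) = 2 ^ 2 by norm_num, Valuation.map_pow]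
      exact pow_lt_one₀ bot_le h2 two_ne_zero
    rw [hQ] at hprod
    -- `|X′|·|4| = |X|`
    have h' : w X' * w 4 = w X := by
      have := hprod
      rw [← mul_assoc, sq] at this
      exact mul_right_cancel₀ hX0.ne' this
    calc w X = w X' * w 4 := h'.symm
      _ < w X' * 1 := by
          refine mul_lt_mul_of_pos_left h4lt ?_
          rw [pos_iff_ne_zero]; intro h0; rw [h0, zero_mul] at h'; exact hX0.ne' h'.symm
      _ = w X' := mul_one _

/-- **Along the orbit `|X_k|` is strictly increasing once `|X_0| > 1`.** [cite: deShalit1987, II §4.9 (i)] -/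
theorem strictMono_val_of_orbit (h2 : w 2 < 1) {ϖ : F} (hϖ : w ϖ < 1) {X : ℕ → F}
    (hrec : ∀ k, X (k + 1) * (4 * X k + 3 - ϖ) = (-1 - ϖ) * X k ^ 2 + (2 * ϖ - 2)) (h0 : 1 < w (X 0)) :
    StrictMono fun k ↦ w (X k) := by
  have hk : ∀ k, 1 < w (X k) := by
    intro k
    induction k with
    | zero => exact h0
    | succ k ih => exact ih.trans (val_lt_val_of_step h2 hϖ ih (hrec k))
  exact strictMono_nat_of_lt_succ fun k ↦ val_lt_val_of_step h2 hϖ (hk k) (hrec k)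

/-- ★★ **Integrality by periodicity of the CM orbit**: if the orbit repeats (`X_k = X_{k′}` for some `k < k′` — the orbit
`π₀ᵏz mod L` of a division point of order prime to `𝔭` is periodic), then `|X_0| ≤ 1`. [cite: deShalit1987, II §4.9 (i) (p. 62–63)] -/
theorem val_le_one_of_orbit (h2 : w 2 < 1) {ϖ : F} (hϖ : w ϖ < 1) {X : ℕ → F}
    (hrec : ∀ k, X (k + 1) * (4 * X k + 3 - ϖ) = (-1 - ϖ) * X k ^ 2 + (2 * ϖ - 2))
    {k k' : ℕ} (hkk : k < k') (hper : X k = X k') : w (X 0) ≤ 1 := by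
  by_contra h0
  push Not at h0
  have h := strictMono_val_of_orbit h2 hϖ hrec h0 hkk
  simp only [hper, lt_self_iff_false] at h

/-! ## §2 Good reduction of the model at `2` -/

variable {V : WeierstrassCurve F}

/-- **`|Δ| = 1`** for the model `[1,−1,0,−2,−1]` in residue characteristic `2`: `Δ = −343 = −7³`, `7 = −1 + 8`.
[cite: SilvermanAEC2009, VII.2.1] -/
theorem val_Δ_cm7 (hV7 : V.a₁ = 1 ∧ V.a₂ = -1 ∧ V.a₃ = 0 ∧ V.a₄ = -2 ∧ V.a₆ = -1) (h2 : w 2 < 1) : w V.Δ = 1 := by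
  obtain ⟨h1, h2', h3, h4, h6⟩ := hV7
  have hΔ : V.Δ = -((-1 + 2 ^ 3) ^ 3) := by
    simp only [WeierstrassCurve.Δ, WeierstrassCurve.b₂, WeierstrassCurve.b₄, WeierstrassCurve.b₆, WeierstrassCurve.b₈, h1, h2', h3,
      h4, h6]
    norm_num
  have h7 : w (-1 + 2 ^ 3 : F) = 1 := by
    rw [w.map_add_eq_of_lt_left]
    · rw [Valuation.map_neg, Valuation.map_one]
    · rw [Valuation.map_neg, Valuation.map_one, Valuation.map_pow]
      exact pow_lt_one₀ bot_le h2 three_ne_zero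
  rw [hΔ, Valuation.map_neg, Valuation.map_pow, h7, one_pow]

/-! ## §3 The unit `x(P) − x(Q)` by reduction modulo `𝔪_w` -/

/-- A residue map `r : 𝒪_w → k` with `ker r = 𝔪_w` (`k` the residue field of the valuation ring, here Mathlib's `w.valuationSubring`;
Silverman's «reduction modulo `π`», `t ↦ t̃`). [cite: SilvermanAEC2009, VII.2 (p. 187, reduction modulo π)] -/
theorem exists_residueMap (w : Valuation F ℝ≥0) :
    ∃ r : w.integer →+* IsLocalRing.ResidueField w.valuationSubring, ∀ a : w.integer, r a = 0 ↔ w (a : F) < 1 := by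
  let incl : w.integer →+* w.valuationSubring :=
    { toFun := fun a ↦ ⟨a.1, a.2⟩
      map_one' := rfl
      map_mul' := fun _ _ ↦ rfl
      map_zero' := rfl
      map_add' := fun _ _ ↦ rfl }
  refine ⟨(IsLocalRing.residue w.valuationSubring).comp incl, fun a ↦ ?_⟩
  rw [RingHom.comp_apply, IsLocalRing.residue_eq_zero_iff, ValuationSubring.valuation_lt_one_iff]
  exact (Valuation.isEquiv_valuation_valuationSubring w).symm.lt_one_iff_lt_one

/-- ★ **`|x(P) − x(Q)| = 1`** for `w`-integral points `P = (x₁, y₁)`, `Q = (x₂, y₂)` of a `w`-integral equation with `|Δ| = 1`,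
provided `P − Q` and `P + Q` are integral points and `P ≠ Q`, `P ≠ −Q`: otherwise `x̃₁ = x̃₂`, so `P̃ = ±Q̃`, and the reduction of the
integral point `P ∓ Q` would be `Õ` (Silverman VII.2.1: reduction is additive on integral points and detects `O`).
[cite: SilvermanAEC2009, Prop. VII.2.1, Prop. VII.3.1] [cite: deShalit1987, II §4.9 (i) (p. 62–63)] -/
theorem val_sub_eq_one_of_isIntegralPoint [V.IsIntegral w.integer] (hΔ : w V.Δ = 1)
    {x₁ y₁ x₂ y₂ : F} {h₁ : V.toAffine.Nonsingular x₁ y₁} {h₂ : V.toAffine.Nonsingular x₂ y₂} (hx₁ : w x₁ ≤ 1) (hx₂ : w x₂ ≤ 1)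
    (hsub : IsIntegralPoint w ((.some x₁ y₁ h₁ : V.toAffine.Point) - .some x₂ y₂ h₂))
    (hadd : IsIntegralPoint w ((.some x₁ y₁ h₁ : V.toAffine.Point) + .some x₂ y₂ h₂))
    (hne : (.some x₁ y₁ h₁ : V.toAffine.Point) ≠ .some x₂ y₂ h₂) (hne' : (.some x₁ y₁ h₁ : V.toAffine.Point) ≠ -.some x₂ y₂ h₂) :
    w (x₁ - x₂) = 1 := by
  obtain ⟨r, hr⟩ := exists_residueMap w
  have hP : IsIntegralPoint w (.some x₁ y₁ h₁ : V.toAffine.Point) := hx₁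
  have hQ : IsIntegralPoint w (.some x₂ y₂ h₂ : V.toAffine.Point) := hx₂
  have hy₁ : w y₁ ≤ 1 := val_y_le_one h₁.1 hx₁
  have hy₂ : w y₂ ≤ 1 := val_y_le_one h₂.1 hx₂
  by_contra hne1
  have hlt : w (x₁ - x₂) < 1 := lt_of_le_of_ne ((w.map_sub _ _).trans (max_le hx₁ hx₂)) hne1
  have hxr : reduceFun r x₁ = reduceFun r x₂ := (reduceFun_eq_iff hr hx₁ hx₂).mpr hlt
  -- the reduced points
  have hPr := reducePoint_some hr hΔ rfl h₁ hx₁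
  have hQr := reducePoint_some hr hΔ rfl h₂ hx₂
  have heq₁ := equation_reduceFun (r := r) h₁.1 hx₁ hy₁
  have heq₂ := equation_reduceFun (r := r) h₂.1 hx₂ hy₂
  by_cases hy : reduceFun r y₁ = (reduceCurve r V).toAffine.negY (reduceFun r x₂) (reduceFun r y₂)
  · -- `P̃ = −Q̃`: then `P + Q` reduces to `Õ`
    have hneg : reducePoint w r (reduceCurve r V) (.some x₁ y₁ h₁ : V.toAffine.Point) =
        -reducePoint w r (reduceCurve r V) (.some x₂ y₂ h₂ : V.toAffine.Point) := by
      rw [hPr, hQr, Affine.Point.neg_some]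
      exact point_some_eq_some hxr hy
    have h0 : reducePoint w r (reduceCurve r V) ((.some x₁ y₁ h₁ : V.toAffine.Point) + .some x₂ y₂ h₂) = 0 := by
      rw [reducePoint_add hr hΔ rfl hP hQ, hneg, neg_add_cancel]
    exact hne' (eq_neg_of_add_eq_zero_left ((reducePoint_eq_zero_iff hr hΔ rfl hadd).mp h0))
  · -- `P̃ = Q̃`: then `P − Q` reduces to `Õ`
    have hyy : reduceFun r y₁ = reduceFun r y₂ := Affine.Y_eq_of_Y_ne heq₁ heq₂ hxr hy
    have heqr : reducePoint w r (reduceCurve r V) (.some x₁ y₁ h₁ : V.toAffine.Point) =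
        reducePoint w r (reduceCurve r V) (.some x₂ y₂ h₂ : V.toAffine.Point) := by
      rw [hPr, hQr]; exact point_some_eq_some hxr hyy
    have hQn : IsIntegralPoint w (-(.some x₂ y₂ h₂ : V.toAffine.Point)) := isIntegralPoint_neg_iff.mpr hQ
    have h0 : reducePoint w r (reduceCurve r V) ((.some x₁ y₁ h₁ : V.toAffine.Point) - .some x₂ y₂ h₂) = 0 := by
      rw [sub_eq_add_neg, reducePoint_add hr hΔ rfl hP hQn, reducePoint_neg rfl, heqr, add_neg_cancel]
    exact hne (sub_eq_zero.mp ((reducePoint_eq_zero_iff hr hΔ rfl (by rwa [sub_eq_add_neg] at hsub ⊢)).mp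
      (by rwa [sub_eq_add_neg] at h0 ⊢)))

end Cm7Orbit

end Literature.NumberTheory.EllipticCurves

end
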